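import Summits.NavierStokesRegularity.NavierStokesRegularity.Theorems.ExtremiserTransienceNearExtremalTransienceExtremiserLiouvilleConstantSpeedSlabTools
import HarnessLib

/-!
# Crux `ExtremiserTransience.NearExtremalTransience` (stmt-NavierStokesRegularity-21883), line `extremiser_liouville`,
# stub K1b — THE SLAB RATE: enstrophy, palinstrophy and gradient energy of an axial jet in the slab `{R/2 ≤ x₂ ≤ 6R}` are `O(1/R)`,
# given a corrector excess `η ≤ C_η/R`

`--supports stmt-NavierStokesRegularity-21883` (helper).  Author: prover seat `ns-el-k1b` (g7).  The far-field Caccioppoli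
inequality (`…FarCaccioppoli`, `…CrossTermsAssembly.farCaccioppoli_weighted`) tested with the axial window cut-off
`θ_{R,ρ}(x) = g(R⁻¹x₂)χ_ρ(x)` (`…AxialCutoff`: `‖Dθ‖ ≤ K/R`, `‖D∇θ‖ ≤ K/R²`, supported in the slab `{R/4 ≤ x₂ ≤ 8R}`) and the
slab energies of the jet (`∫_{R/4≤x₂≤8R}‖V‖² ≤ 10E₀R`, sandwich of g5):

(tools `integral_mul_frobeniusNormSq_fderiv_le`, `integral_indicator_slab_sq_le` in `…ConstantSpeedSlabTools`)
* `slabRate_of_corrector_bound` — **for the constant-speed axial residue JET, every `R ≥ 1`, `ρ ≥ R`, if `‖v − c‖ ≤ κ⋆M/3` on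
  `{x₂ ≥ R/4}` and the Leray corrector of `θ_{R,ρ}(v−c)` has `‖∇π‖ ≤ C_η/R`, then**
  `W·∫θ‖ω‖² + Z·∫θ|Dω|²_F ≤ C/R` **and** `∫θ|Dv|²_F ≤ C'/R` with constants `C, C'` INDEPENDENT of `R, ρ`
  (explicit in `M, Z, W, S, E₀, ∫‖Dv‖², K, C_η`).
The corrector hypothesis is discharged in the companion file `…ConstantSpeedSlabCorrector` (anisotropic Newton bound for the axial
part of `div(θV)`, isotropic bound for the radial part, `ρ` large); the window `H¹` rate and the kill of energetic-window jets
follow in `…ConstantSpeedSlabKill`.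

WHAT THIS IS NOT: K1b is NOT proved; nothing here proves NS regularity. [folklore]
-/

noncomputable section

open Set Filter Topology MeasureTheory Metric Function Real
open scoped ENNReal NNReal Topology InnerProductSpace RealInnerProductSpace ContDiff

namespace Summit.NavierStokesRegularity.NavierStokesRegularity.Theorems

-- the problem directory repeats the summit name (`NavierStokesRegularity/NavierStokesRegularity`)
set_option linter.dupNamespace false

namespace ExtremiserLiouville

open Literature.Analysis.FluidPDE Literature.Analysis
open DepletionLadder.KStar DepletionLadder.KStar.HalfSpace

variable {v : E3 → E3} {c : E3}

/-! ## 3. The slab rate, given a corrector bound -/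

set_option maxHeartbeats 400000 in
/-- **THE SLAB RATE (conditional on the corrector excess).**  Constant-speed axial residue JET (`‖v‖ ≡ M = ‖c‖`, `c ∥ e₂`,
`|S| = κ⋆M√Z√W`, all slabs square integrable, window energies `≡ E₀`), and a constant `C_η ≥ 0`.  There is `C ≥ 0` such that
for all `1 ≤ R ≤ ρ`: if `‖v − c‖ ≤ κ⋆M/3` on `{x₂ ≥ R/4}` and the Leray corrector of the axial window truncation satisfies
`‖∇π[θ_{R,ρ}(v − c)]‖ ≤ C_η/R` everywhere, then
`W·∫θ‖ω‖² + Z·∫θ|Dω|²_F ≤ C/R` and `∫θ|Dv|²_F ≤ C/R` (`θ = θ_{R,ρ}` the axial window cut-off, `= 1` on `{R/2 ≤ x₂ ≤ 6R} ∩ B̄_ρ`).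
[folklore] -/
theorem slabRate_of_corrector_bound
    (hv : ContDiff ℝ ∞ v) (hdiv : VectorCalculus.IsDivFree v) {M B : ℝ} (hMpos : 0 < M)
    (hM : ∀ x, ‖v x‖ = M) (hcM : ‖c‖ = M) (hB : ∀ x, ‖fderiv ℝ v x‖ ≤ B)
    (h1 : ∫⁻ x, ‖iteratedFDeriv ℝ 1 v x‖ₑ ^ 2 < ⊤) (h2 : ∫⁻ x, ‖iteratedFDeriv ℝ 2 v x‖ₑ ^ 2 < ⊤)
    (hpos : 0 < M * Real.sqrt (Zen v) * Real.sqrt (Wpa v))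
    (hatt : |Jst v| = kStar * M * Real.sqrt (Zen v) * Real.sqrt (Wpa v))
    (hc0 : c 0 = 0) (hc1 : c 1 = 0) (hc2 : c 2 ≠ 0)
    (hslab : ∀ T : ℝ, 0 < T → Integrable (fun x => {x : E3 | |x 2| ≤ T}.indicator (fun x => ‖v x - c‖ ^ 2) x) volume)
    {E₀ : ℝ} (hE0 : 0 ≤ E₀) (hE : ∀ s : ℝ, (∫ x, deriv Real.smoothTransition (x 2 - s) * ‖v x - c‖ ^ 2) = E₀)
    {Cη : ℝ} (hCη : 0 ≤ Cη) :
    ∃ C : ℝ, 0 ≤ C ∧ ∀ R ρ : ℝ, 1 ≤ R → R ≤ ρ →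
      (∀ x : E3, R / 4 ≤ x 2 → ‖v x - c‖ ≤ kStar * M / 3) →
      (∀ y : E3, ‖gradient (divPotential (fun x : E3 =>
          (Real.smoothTransition (4 * (R⁻¹ * x 2) - 1) * Real.smoothTransition (4 - R⁻¹ * x 2 / 2) * cutoff ρ x) •
            (v x - c))) y‖ ≤ Cη / R) →
      Wpa v * (∫ x, (Real.smoothTransition (4 * (R⁻¹ * x 2) - 1) * Real.smoothTransition (4 - R⁻¹ * x 2 / 2) * cutoff ρ x) *
            ‖curl v x‖ ^ 2) +
        Zen v * (∫ x, (Real.smoothTransition (4 * (R⁻¹ * x 2) - 1) * Real.smoothTransition (4 - R⁻¹ * x 2 / 2) * cutoff ρ x) *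
            frobeniusNormSq (fderiv ℝ (curl v) x)) ≤ C / R ∧
      (∫ x, (Real.smoothTransition (4 * (R⁻¹ * x 2) - 1) * Real.smoothTransition (4 - R⁻¹ * x 2 / 2) * cutoff ρ x) *
          frobeniusNormSq (fderiv ℝ v x)) ≤ C / R := by
  obtain ⟨K, hK0, hK⟩ := exists_axialCutoff_weights
  -- global quantities
  have hZdef : Zen v = ∫ x, ‖curl v x‖ ^ 2 := rfl
  have hWdef : Wpa v = ∫ x, frobeniusNormSq (fderiv ℝ (curl v) x) := rfl
  have hZ0 : 0 ≤ Zen v := integral_nonneg fun x => sq_nonneg _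
  have hW0 : 0 ≤ Wpa v := integral_nonneg fun x => frobeniusNormSq_nonneg _
  have hWpos : 0 < Wpa v := by
    rcases hW0.lt_or_eq with h | h
    · exact h
    · exfalso; rw [← h, Real.sqrt_zero, mul_zero] at hpos; exact lt_irrefl _ hpos
  have hK0R : 0 < kStar := kStar_pos
  have iZ : Integrable (fun x => ‖curl v x‖ ^ 2) volume := (integrable_norm_curl_sq (hv.of_le (by norm_cast)) h1).1
  have iW : Integrable (fun x => frobeniusNormSq (fderiv ℝ (curl v) x)) volume :=
    (integrable_frobeniusNormSq_fderiv_curl (hv.of_le (by norm_cast)) h2).1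
  have iD : Integrable (fun x => ‖fderiv ℝ v x‖ ^ 2) volume := by
    have h1' : ∫⁻ x, ‖fderiv ℝ v x‖ₑ ^ 2 < ⊤ := by
      refine lt_of_le_of_lt (le_of_eq (lintegral_congr fun x => ?_)) h1
      rw [← ofReal_norm, ← ofReal_norm, norm_iteratedFDeriv_one]
    exact integrable_sq_norm_of_lintegral_lt_top (hv.continuous_fderiv (by simp)) h1'
  set D : ℝ := ∫ x, ‖fderiv ℝ v x‖ ^ 2 with hDdef
  have hD0 : 0 ≤ D := integral_nonneg fun x => sq_nonneg _
  set σ : ℝ := kStar * M / 3 with hσdef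
  have hσ0 : 0 ≤ σ := by rw [hσdef]; positivity
  -- the constant
  set C₀ : ℝ := 3 * |Jst v| * σ * (K * Zen v) + |Jst v| * σ * (K * (D + 2 * Zen v)) +
    kStar ^ 2 * M ^ 2 * ((5 / 2 : ℝ) * Wpa v * (10 * K * E₀) + (3 / 2 : ℝ) * Zen v * (K * (3 * Wpa v + Zen v + D + 10 * E₀))) +
    (kStar + kStar ^ 2) * M * Zen v * Wpa v * Cη with hC₀
  have hC₀0 : 0 ≤ C₀ := by rw [hC₀]; positivity
  clear_value C₀
  set C : ℝ := 2 * C₀ / (kStar ^ 2 * M ^ 2) + (2 * C₀ / (kStar ^ 2 * M ^ 2) / Wpa v + 10 * K * E₀) with hCdef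
  refine ⟨C, by positivity, fun R ρ hR hRρ hσR hη => ?_⟩
  have hR0 : 0 < R := one_pos.trans_le hR
  have hρ0 : 0 < ρ := hR0.trans_le hRρ
  -- the cut-off
  set θ : E3 → ℝ := fun x : E3 => Real.smoothTransition (4 * (R⁻¹ * x 2) - 1) * Real.smoothTransition (4 - R⁻¹ * x 2 / 2) *
    cutoff ρ x with hθdef
  have hθ : ContDiff ℝ ∞ θ := contDiff_axialCutoff R ρ
  have hθc : HasCompactSupport θ := hasCompactSupport_axialCutoff R hρ0
  have hθ01 : ∀ x, 0 ≤ θ x ∧ θ x ≤ 1 := axialCutoff_nonneg_le_one R ρ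
  have hts := tsupport_axialCutoff_subset hR0 ρ
  have hσ' : ∀ x ∈ tsupport θ, ‖v x - c‖ ≤ σ := fun x hx => hσR x (hts hx).1
  have hσK : 3 * σ ≤ kStar * M := by rw [hσdef]; linarith
  have hKx := hK R ρ hR hRρ
  -- the corrector
  set G : E3 → E3 := fun y => θ y • (v y - c) with hGdef
  have hV : ContDiff ℝ ∞ (fun y => v y - c) := hv.sub contDiff_const
  have cV : Continuous (fun y => v y - c) := hV.continuous
  have hG : ContDiff ℝ ∞ G := hθ.smul hV
  have hGc : HasCompactSupport G := hθc.smul_right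
  have hV2M : ∀ x, ‖v x - c‖ ≤ 2 * M := fun x => by
    calc ‖v x - c‖ ≤ ‖v x‖ + ‖c‖ := norm_sub_le _ _
      _ = 2 * M := by rw [hM x, hcM]; ring
  have hdivG : ∀ x, |VectorCalculus.divergence G x| ≤ K / R * (2 * M) := by
    intro x
    have hθd : DifferentiableAt ℝ θ x := (hθ.differentiable (by simp)) x
    have hVd : DifferentiableAt ℝ (fun y => v y - c) x := (hV.differentiable (by simp)) x
    rw [hGdef, divergence_smul_apply hθd hVd, isDivFree_sub_const hdiv c x, mul_zero, zero_add, real_inner_comm, gradient,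
      InnerProductSpace.toDual_symm_apply, ← Real.norm_eq_abs]
    calc ‖fderiv ℝ θ x (v x - c)‖ ≤ ‖fderiv ℝ θ x‖ * ‖v x - c‖ := (fderiv ℝ θ x).le_opNorm _
      _ ≤ K / R * (2 * M) := mul_le_mul (hKx x).1 (hV2M x) (norm_nonneg _) (by positivity)
  obtain ⟨hp, -, ⟨Bp, hBp⟩, hp1, hp2⟩ := lerayCorrector_bounds hG hGc hdivG
  have hudiv : VectorCalculus.IsDivFree (fun x => (1 - θ x) • (v x - c) + gradient (divPotential G) x) := by
    have e : (fun x => (1 - θ x) • (v x - c) + gradient (divPotential G) x) =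
        fun x => (v x - c) + (-1 : ℝ) • classicalLerayProj G x := by
      funext x
      rw [classicalLerayProj_apply]
      simp only [hGdef, sub_smul, one_smul, smul_sub, neg_one_smul]
      abel
    rw [e]
    intro x
    have hVd : Differentiable ℝ (fun y => v y - c) := hV.differentiable (by simp)
    have hPd : Differentiable ℝ (classicalLerayProj G) := (contDiff_classicalLerayProj hG hGc).differentiable (by simp)
    rw [divergence_add_smul hVd hPd, isDivFree_sub_const hdiv c x, isDivFree_classicalLerayProj hG hGc x, mul_zero, add_zero]
  -- the weighted far-field Caccioppoli inequality
  have hmain := farCaccioppoli_weighted hv hdiv hMpos hM hcM hB h1 h2 hpos hatt hθ hθc hθ01 hσ0 hσ' hσK hp hη hBp hp1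
    hp2 hudiv
  -- the four weight integrals
  have cω : Continuous (curl v) := (contDiff_curl_top hv).continuous
  have cDω : Continuous (fderiv ℝ (curl v)) := (contDiff_curl_top hv).continuous_fderiv (by simp)
  have cDv : Continuous (fderiv ℝ v) := hv.continuous_fderiv (by simp)
  have cF : Continuous (fun x => frobeniusNormSq (fderiv ℝ (curl v) x)) :=
    continuous_frobeniusNormSq_fderiv ((contDiff_curl_top hv).of_le (by norm_cast)) one_ne_zero
  have cDθ : Continuous (fderiv ℝ θ) := hθ.continuous_fderiv (by simp)
  have cDg : Continuous (fderiv ℝ (gradient θ)) := (contDiff_gradient_top hθ).continuous_fderiv (by simp)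
  have hDθc : HasCompactSupport (fderiv ℝ θ) := hθc.fderiv (𝕜 := ℝ)
  have hDgc : HasCompactSupport (fderiv ℝ (gradient θ)) := (hasCompactSupport_gradient hθc).fderiv (𝕜 := ℝ)
  -- T1
  have hT1 : (∫ x, ‖fderiv ℝ θ x‖ * ‖curl v x‖ ^ 2) ≤ K / R * Zen v := by
    rw [hZdef, ← integral_const_mul]
    refine integral_mono ((cDθ.norm.mul (cω.norm.pow 2)).integrable_of_hasCompactSupport hDθc.norm.mul_right)
      (iZ.const_mul _) fun x => ?_
    exact mul_le_mul_of_nonneg_right (hKx x).1 (sq_nonneg _)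
  -- T2
  have hT2 : (∫ x, ‖fderiv ℝ θ x‖ * (‖fderiv ℝ v x‖ ^ 2 + 2 * ‖curl v x‖ ^ 2)) ≤ K / R * (D + 2 * Zen v) := by
    have e : K / R * (D + 2 * Zen v) = ∫ x, K / R * (‖fderiv ℝ v x‖ ^ 2 + 2 * ‖curl v x‖ ^ 2) := by
      rw [integral_const_mul, integral_add iD (iZ.const_mul 2), integral_const_mul, hZdef]
    rw [e]
    refine integral_mono ((cDθ.norm.mul ((cDv.norm.pow 2).add (continuous_const.mul (cω.norm.pow 2)))).integrable_of_hasCompactSupport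
      hDθc.norm.mul_right) ((iD.add (iZ.const_mul 2)).const_mul _) fun x => ?_
    exact mul_le_mul_of_nonneg_right (hKx x).1 (by positivity)
  -- T3
  have hslabE := integral_indicator_slab_sq_le hv hdiv hM hcM hc0 hc1 hc2 hslab hE0 hE hR
  have iE : Integrable (fun x => {x : E3 | R / 4 ≤ x 2 ∧ x 2 ≤ 8 * R}.indicator (fun x => ‖v x - c‖ ^ 2) x) volume := by
    have hT0 : 0 < 8 * R := by positivity
    have h8 : -(8 * R) ≤ R / 4 := by linarith
    exact integrable_indicator_slab_mul_sq cV h8 le_rfl (hslab (8 * R) hT0)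
  have hT3 : (∫ x, ‖fderiv ℝ (gradient θ) x‖ * ‖v x - c‖ ^ 2) ≤ 10 * K * E₀ / R := by
    have hpt : ∀ x, ‖fderiv ℝ (gradient θ) x‖ * ‖v x - c‖ ^ 2 ≤
        K / R ^ 2 * {x : E3 | R / 4 ≤ x 2 ∧ x 2 ≤ 8 * R}.indicator (fun x => ‖v x - c‖ ^ 2) x := by
      intro x
      by_cases hx : R / 4 ≤ x 2 ∧ x 2 ≤ 8 * R
      · rw [indicator_of_mem (show x ∈ {x : E3 | R / 4 ≤ x 2 ∧ x 2 ≤ 8 * R} from hx)]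
        exact mul_le_mul_of_nonneg_right (hKx x).2.1 (sq_nonneg _)
      · rw [((hKx x).2.2 hx).2, norm_zero, zero_mul]
        exact mul_nonneg (by positivity) (indicator_nonneg (fun y _ => sq_nonneg _) _)
    calc (∫ x, ‖fderiv ℝ (gradient θ) x‖ * ‖v x - c‖ ^ 2)
        ≤ ∫ x, K / R ^ 2 * {x : E3 | R / 4 ≤ x 2 ∧ x 2 ≤ 8 * R}.indicator (fun x => ‖v x - c‖ ^ 2) x :=
          integral_mono ((cDg.norm.mul (cV.norm.pow 2)).integrable_of_hasCompactSupport hDgc.norm.mul_right)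
            (iE.const_mul _) hpt
      _ = K / R ^ 2 * ∫ x, {x : E3 | R / 4 ≤ x 2 ∧ x 2 ≤ 8 * R}.indicator (fun x => ‖v x - c‖ ^ 2) x :=
          integral_const_mul _ _
      _ ≤ K / R ^ 2 * (10 * R * E₀) := mul_le_mul_of_nonneg_left hslabE (by positivity)
      _ = 10 * K * E₀ / R := by field_simp
  -- T4
  have hT4 : (∫ x, (‖fderiv ℝ θ x‖ * (2 * frobeniusNormSq (fderiv ℝ (curl v) x) + ‖curl v x‖ ^ 2 + ‖fderiv ℝ v x‖ ^ 2) +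
      ‖fderiv ℝ (gradient θ) x‖ * (frobeniusNormSq (fderiv ℝ (curl v) x) + ‖v x - c‖ ^ 2))) ≤
      K / R * (3 * Wpa v + Zen v + D + 10 * E₀) := by
    have i4a : Integrable (fun x => ‖fderiv ℝ θ x‖ * (2 * frobeniusNormSq (fderiv ℝ (curl v) x) + ‖curl v x‖ ^ 2 +
        ‖fderiv ℝ v x‖ ^ 2)) volume :=
      (cDθ.norm.mul (((continuous_const.mul cF).add (cω.norm.pow 2)).add (cDv.norm.pow 2))).integrable_of_hasCompactSupport
        hDθc.norm.mul_right
    have i4b : Integrable (fun x => ‖fderiv ℝ (gradient θ) x‖ * frobeniusNormSq (fderiv ℝ (curl v) x)) volume :=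
      (cDg.norm.mul cF).integrable_of_hasCompactSupport hDgc.norm.mul_right
    have i4c : Integrable (fun x => ‖fderiv ℝ (gradient θ) x‖ * ‖v x - c‖ ^ 2) volume :=
      (cDg.norm.mul (cV.norm.pow 2)).integrable_of_hasCompactSupport hDgc.norm.mul_right
    have e : (∫ x, (‖fderiv ℝ θ x‖ * (2 * frobeniusNormSq (fderiv ℝ (curl v) x) + ‖curl v x‖ ^ 2 + ‖fderiv ℝ v x‖ ^ 2) +
        ‖fderiv ℝ (gradient θ) x‖ * (frobeniusNormSq (fderiv ℝ (curl v) x) + ‖v x - c‖ ^ 2))) =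
        (∫ x, ‖fderiv ℝ θ x‖ * (2 * frobeniusNormSq (fderiv ℝ (curl v) x) + ‖curl v x‖ ^ 2 + ‖fderiv ℝ v x‖ ^ 2)) +
          ((∫ x, ‖fderiv ℝ (gradient θ) x‖ * frobeniusNormSq (fderiv ℝ (curl v) x)) +
            ∫ x, ‖fderiv ℝ (gradient θ) x‖ * ‖v x - c‖ ^ 2) := by
      have i4bc : Integrable (fun x => ‖fderiv ℝ (gradient θ) x‖ * frobeniusNormSq (fderiv ℝ (curl v) x) +
          ‖fderiv ℝ (gradient θ) x‖ * ‖v x - c‖ ^ 2) volume := i4b.add i4c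
      rw [← integral_add i4b i4c, ← integral_add i4a i4bc]
      refine integral_congr_ae (Eventually.of_forall fun x => ?_)
      ring
    have ha : (∫ x, ‖fderiv ℝ θ x‖ * (2 * frobeniusNormSq (fderiv ℝ (curl v) x) + ‖curl v x‖ ^ 2 + ‖fderiv ℝ v x‖ ^ 2)) ≤
        K / R * (2 * Wpa v + Zen v + D) := by
      have iWZ : Integrable (fun x => 2 * frobeniusNormSq (fderiv ℝ (curl v) x) + ‖curl v x‖ ^ 2) volume :=
        (iW.const_mul 2).add iZ
      have iWZD : Integrable (fun x => 2 * frobeniusNormSq (fderiv ℝ (curl v) x) + ‖curl v x‖ ^ 2 + ‖fderiv ℝ v x‖ ^ 2)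
          volume := iWZ.add iD
      have e2 : K / R * (2 * Wpa v + Zen v + D) =
          ∫ x, K / R * (2 * frobeniusNormSq (fderiv ℝ (curl v) x) + ‖curl v x‖ ^ 2 + ‖fderiv ℝ v x‖ ^ 2) := by
        rw [integral_const_mul, integral_add iWZ iD, integral_add (iW.const_mul 2) iZ, integral_const_mul, hZdef, hWdef]
      rw [e2]
      refine integral_mono i4a (iWZD.const_mul _) fun x => ?_
      exact mul_le_mul_of_nonneg_right (hKx x).1
        (add_nonneg (add_nonneg (mul_nonneg zero_le_two (frobeniusNormSq_nonneg _)) (sq_nonneg _)) (sq_nonneg _))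
    have hb : (∫ x, ‖fderiv ℝ (gradient θ) x‖ * frobeniusNormSq (fderiv ℝ (curl v) x)) ≤ K / R ^ 2 * Wpa v := by
      rw [hWdef, ← integral_const_mul]
      refine integral_mono i4b (iW.const_mul _) fun x => ?_
      exact mul_le_mul_of_nonneg_right (hKx x).2.1 (frobeniusNormSq_nonneg _)
    have hb' : K / R ^ 2 * Wpa v ≤ K / R * Wpa v := by
      refine mul_le_mul_of_nonneg_right ?_ hW0
      have hRR : R ≤ R ^ 2 := by
        rw [sq]
        have := mul_le_mul_of_nonneg_left hR hR0.le
        linarith [this]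
      exact div_le_div_of_nonneg_left hK0.le hR0 hRR
    rw [e]
    have : K / R * (3 * Wpa v + Zen v + D + 10 * E₀) =
        K / R * (2 * Wpa v + Zen v + D) + K / R * Wpa v + 10 * K * E₀ / R := by ring
    rw [this]
    linarith [ha, hb, hb', hT3]
  -- assemble the first bound
  have hS0 : 0 ≤ |Jst v| := abs_nonneg _
  have hKM2 : 0 < kStar ^ 2 * M ^ 2 := by positivity
  have hineq : kStar ^ 2 * M ^ 2 * (Wpa v * (∫ x, θ x * ‖curl v x‖ ^ 2) +
      Zen v * (∫ x, θ x * frobeniusNormSq (fderiv ℝ (curl v) x))) / 2 ≤ C₀ / R := by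
    have b1 : 3 * |Jst v| * σ * (∫ x, ‖fderiv ℝ θ x‖ * ‖curl v x‖ ^ 2) ≤ 3 * |Jst v| * σ * (K / R * Zen v) :=
      mul_le_mul_of_nonneg_left hT1 (by positivity)
    have b2 : |Jst v| * σ * (∫ x, ‖fderiv ℝ θ x‖ * (‖fderiv ℝ v x‖ ^ 2 + 2 * ‖curl v x‖ ^ 2)) ≤
        |Jst v| * σ * (K / R * (D + 2 * Zen v)) := mul_le_mul_of_nonneg_left hT2 (by positivity)
    have b3 : kStar ^ 2 * M ^ 2 * ((5 / 2 : ℝ) * Wpa v * (∫ x, ‖fderiv ℝ (gradient θ) x‖ * ‖v x - c‖ ^ 2) +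
        (3 / 2 : ℝ) * Zen v * ∫ x, (‖fderiv ℝ θ x‖ * (2 * frobeniusNormSq (fderiv ℝ (curl v) x) + ‖curl v x‖ ^ 2 +
          ‖fderiv ℝ v x‖ ^ 2) + ‖fderiv ℝ (gradient θ) x‖ * (frobeniusNormSq (fderiv ℝ (curl v) x) + ‖v x - c‖ ^ 2))) ≤
        kStar ^ 2 * M ^ 2 * ((5 / 2 : ℝ) * Wpa v * (10 * K * E₀ / R) + (3 / 2 : ℝ) * Zen v * (K / R * (3 * Wpa v + Zen v + D + 10 * E₀))) := by
      refine mul_le_mul_of_nonneg_left (add_le_add ?_ ?_) hKM2.le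
      · exact mul_le_mul_of_nonneg_left hT3 (by positivity)
      · exact mul_le_mul_of_nonneg_left hT4 (by positivity)
    have e : C₀ / R = 3 * |Jst v| * σ * (K / R * Zen v) + |Jst v| * σ * (K / R * (D + 2 * Zen v)) +
        kStar ^ 2 * M ^ 2 * ((5 / 2 : ℝ) * Wpa v * (10 * K * E₀ / R) + (3 / 2 : ℝ) * Zen v * (K / R * (3 * Wpa v + Zen v + D + 10 * E₀))) +
        (kStar + kStar ^ 2) * M * Zen v * Wpa v * (Cη / R) := by
      rw [hC₀]; ring
    rw [e]
    linarith [hmain, b1, b2, b3]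
  set X : ℝ := Wpa v * (∫ x, θ x * ‖curl v x‖ ^ 2) + Zen v * (∫ x, θ x * frobeniusNormSq (fderiv ℝ (curl v) x)) with hXdef
  set A₀ : ℝ := 2 * C₀ / (kStar ^ 2 * M ^ 2) with hA₀
  have hA₀0 : 0 ≤ A₀ := by rw [hA₀]; exact div_nonneg (mul_nonneg zero_le_two hC₀0) hKM2.le
  clear_value A₀
  have hfirst : X ≤ A₀ / R := by
    have h := mul_le_mul_of_nonneg_left hineq (show 0 ≤ 2 / (kStar ^ 2 * M ^ 2) by positivity)
    have e1 : 2 / (kStar ^ 2 * M ^ 2) * (kStar ^ 2 * M ^ 2 * X / 2) = X := by field_simp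
    have e2 : 2 / (kStar ^ 2 * M ^ 2) * (C₀ / R) = A₀ / R := by rw [hA₀]; field_simp
    rw [e1, e2] at h
    exact h
  have hZθ0 : 0 ≤ ∫ x, θ x * ‖curl v x‖ ^ 2 := integral_nonneg fun x => mul_nonneg (hθ01 x).1 (sq_nonneg _)
  have hWθ0 : 0 ≤ ∫ x, θ x * frobeniusNormSq (fderiv ℝ (curl v) x) :=
    integral_nonneg fun x => mul_nonneg (hθ01 x).1 (frobeniusNormSq_nonneg _)
  -- the enstrophy of the window alone
  have hZθ : (∫ x, θ x * ‖curl v x‖ ^ 2) ≤ A₀ / Wpa v / R := by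
    have hWZ : Wpa v * (∫ x, θ x * ‖curl v x‖ ^ 2) ≤ A₀ / R := by
      have : 0 ≤ Zen v * (∫ x, θ x * frobeniusNormSq (fderiv ℝ (curl v) x)) := mul_nonneg hZ0 hWθ0
      linarith [hfirst]
    rw [div_right_comm, le_div_iff₀ hWpos, mul_comm]
    exact hWZ
  have hC1 : A₀ ≤ C := by
    rw [hCdef]
    have : 0 ≤ A₀ / Wpa v + 10 * K * E₀ := by positivity
    linarith
  have hC2 : A₀ / Wpa v + 10 * K * E₀ ≤ C := by rw [hCdef]; linarith
  refine ⟨(hfirst.trans (div_le_div_of_nonneg_right hC1 hR0.le)), ?_⟩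
  calc (∫ x, θ x * frobeniusNormSq (fderiv ℝ v x))
      ≤ (∫ x, θ x * ‖curl v x‖ ^ 2) + ∫ x, ‖fderiv ℝ (gradient θ) x‖ * ‖v x - c‖ ^ 2 :=
        integral_mul_frobeniusNormSq_fderiv_le hv hdiv hθ hθc
    _ ≤ A₀ / Wpa v / R + 10 * K * E₀ / R := add_le_add hZθ hT3
    _ = (A₀ / Wpa v + 10 * K * E₀) / R := by ring
    _ ≤ C / R := div_le_div_of_nonneg_right hC2 hR0.le

end ExtremiserLiouville

end Summit.NavierStokesRegularity.NavierStokesRegularity.Theorems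

end
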